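import Mathlib
import HarnessLib.Audit
import Summits.PneNP.PneNP.Theorems.PstarNorUnitTools

/-!
# A NOR-forced chord is a CONS-T unit with SINGLE literals (ROUND-24, memo §9 R7/R8; O5 "composite literals" is impossible)

FRONTIER range-avoidance ladder, rung F-N3, ROUND 24 (cell `pnp-ideate`, planner memo `r24/CORE-BOUND-NOTES.md` §9 R7 (NOR case) / R8, §10 O5,
§13; restricted-model proof complexity — nothing here bears on `P` versus `NP`).

**Theorem `nor_unit`.**  Pure `P⋆` instance with simple overlaps, `(r, 3/2)`-boundary expanding.  Data of ONE forced chord in the NOR case of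
`PstarChordForcing.forced_chord_cases`, read on the instance:
* `P` — the chord's fundamental path family, `e ∉ P` the chord, closing `P` into an XOR cycle (no XOR variable of `P ∪ {e}` on the boundary of
  `P ∪ {e}` — true for the terminal core's fundamental cycles, which are XOR-closed);
* the NOR identity `Q_P + c = μ₁ m₁ + μ₂ m₂` (`μ_i = λ_i + 1`, `m_i` affine) and the rank hypothesis `codim rad B_P ≥ 4` (`PstarPathRank`);
* `G` — outputs disjoint from `P ∪ {e}` REALISING THE LITERAL PRODUCTS: whenever `ℓ₁(e_v)ℓ₂(e_w) + ℓ₁(e_w)ℓ₂(e_v) = 1` (i.e. `{v,w}` is a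
  quadratic monomial of `λ₁λ₂`, equivalently of the second constraint `q = λ₁λ₂ + 1`), some `g ∈ G` has AND pair `{v, w}` (in the bridge:
  `w₂`'s folded pendants / x-read tree monomials); `#(P ∪ {e} ∪ G) ≤ r`.
CONCLUSION: `P = {j₁, j₂}` with disjoint AND pairs, literals `σ ∈ andPair j₁`, `τ ∈ andPair j₂` such that the literal variables (those with
`ℓ₁(e_v) ≠ 0 ∨ ℓ₂(e_v) ≠ 0`) are EXACTLY `{σ, τ}`, and a gadget `g ∈ G` with AND pair `{σ, τ}`.  So the literal span is spanned by two
COORDINATES (single literals — memo O5's composite classes never occur), the forced path is the CONS-T pair `(σ,b)(τ,b′)`, and the NOR gadget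
`(σ,τ)` exists: the local shape of `PstarLitNorCore.LitNorStructure`.

Proof: `PstarNorUnitPolar` (rank `B_P = 4`: no induced 3-matching, no literal off the path, `adj_eq`) + `PstarNorUnitGraph` (`2K₂` or
cherry-plus-edge) + `PstarNorUnitTools` (`𝔽₂²` type facts, all-minors-zero ⟹ rank `≤ 2`, boundary of cycle-plus-gadgets): the cherry dies by one
gadget (`14 < 15`) or by the rank bound; a two-literal edge dies by two gadgets (`14 < 15` / `12 < 15`); what is left is one literal per edge.
Sanity: exhaustive enumeration of the combinatorial core for `≤ 7` AND variables (kit j307174).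
-/

set_option linter.dupNamespace false -- `Summit.PneNP.PneNP.…`: summit = sub-problem name (D-0017 single-conjunct layout)

open Finset Module Literature.Computability.Complexity
open Summit.PneNP.PneNP.Theorems.PstarSALevel (varSet bdry BoundaryExpanding SimpleOverlap)
open Summit.PneNP.PneNP.Theorems.PstarGapLinearised (andPair andPair_subset_varSet)
open Summit.PneNP.PneNP.Theorems.PstarChordEndgameTools (mem_andPair_iff)
open Summit.PneNP.PneNP.Theorems.PstarCubeIdeals (IsAffineFn)
open Summit.PneNP.PneNP.Theorems.PstarQuadRank (rad)
open Summit.PneNP.PneNP.Theorems.PstarRankRigidityTwo (linPart)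
open Summit.PneNP.PneNP.Theorems.PstarProductRank (qform polar IsInducedMatching)
open Summit.PneNP.PneNP.Theorems.PstarPathRank (AndAdj and_ne)
open Summit.PneNP.PneNP.Theorems.PstarNorUnitPolar (exists_mem_andPair_of_lit adj_eq card_le_two_of_isInducedMatching two_le_card)
open Summit.PneNP.PneNP.Theorems.PstarNorUnitGraph (adeg leafEdges mem_leafEdges adeg_pos card_leaves_le two_edges_or_cherry)
open Summit.PneNP.PneNP.Theorems.PstarNorUnitTools (lit_of_adj three_profiles det_of_outside det_or_eq rank_lt_of_dets_zero card_bdry_union_le)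

namespace Summit.PneNP.PneNP.Theorems.PstarNorUnitCases

variable {n m : ℕ}

/-- In `𝔽₂`, `x + x = 0`. -/
private theorem zmod2_add_self (x : ZMod 2) : x + x = 0 := by
  revert x; decide

/-- A minor equal to `1` has both profiles non-zero. -/
theorem lits_of_det {s₁ s₂ v₁ v₂ : ZMod 2} (h : s₁ * v₂ + v₁ * s₂ = 1) : (s₁ ≠ 0 ∨ s₂ ≠ 0) ∧ (v₁ ≠ 0 ∨ v₂ ≠ 0) := by
  revert h s₁ s₂ v₁ v₂; decide

/-- **Three equal profiles are contradictory** (equational form of `PstarNorUnitTools.three_profiles`): `π_x = π_y = π_z`,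
`[y~z] = 1`, `[x~y] = [x~z] = 0` is impossible. -/
theorem three_profiles' {lx₁ lx₂ ly₁ ly₂ lz₁ lz₂ nx₁ nx₂ ny₁ ny₂ nz₁ nz₂ : ZMod 2} (h₁ : lx₁ = ly₁) (h₂ : lx₂ = ly₂) (h₃ : lx₁ = lz₁)
    (h₄ : lx₂ = lz₂) (hyz : ly₁ * nz₁ + lz₁ * ny₁ + (ly₂ * nz₂ + lz₂ * ny₂) = 1) (hxy : lx₁ * ny₁ + ly₁ * nx₁ + (lx₂ * ny₂ + ly₂ * nx₂) = 0)
    (hxz : lx₁ * nz₁ + lz₁ * nx₁ + (lx₂ * nz₂ + lz₂ * nx₂) = 0) : False := by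
  subst h₁ h₂ h₃ h₄
  revert hyz hxy hxz lx₁ lx₂ nx₁ nx₂ ny₁ ny₂ nz₁ nz₂; decide

/-! ## Elementary facts about AND pairs -/

/-- An AND pair containing two distinct variables is exactly that pair. -/
theorem andPair_eq_of_mem {I : LocalMap 4 n m} {g : Fin m} {x y : Fin n} (hx : x ∈ andPair I g) (hy : y ∈ andPair I g) (hxy : x ≠ y) :
    andPair I g = {x, y} := by
  rw [mem_andPair_iff] at hx hy
  unfold PstarGapLinearised.andPair
  rcases hx with rfl | rfl <;> rcases hy with rfl | rfl
  · exact absurd rfl hxy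
  · rfl
  · exact pair_comm _ _
  · exact absurd rfl hxy

/-- Adjacency from membership. -/
theorem andAdj_of_mem {I : LocalMap 4 n m} {P : Finset (Fin m)} {j : Fin m} (hj : j ∈ P) {v w : Fin n} (hvw : v ≠ w) (hv : v ∈ andPair I j)
    (hw : w ∈ andPair I j) : AndAdj I P v w := by
  rw [mem_andPair_iff] at hv hw
  rcases hv with rfl | rfl <;> rcases hw with rfl | rfl
  · exact absurd rfl hvw
  · exact ⟨j, hj, Or.inl ⟨rfl, rfl⟩⟩
  · exact ⟨j, hj, Or.inr ⟨rfl, rfl⟩⟩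
  · exact absurd rfl hvw

/-- Membership from adjacency. -/
theorem mem_of_andAdj {I : LocalMap 4 n m} {P : Finset (Fin m)} {v w : Fin n} (h : AndAdj I P v w) :
    ∃ j ∈ P, v ∈ andPair I j ∧ w ∈ andPair I j := by
  obtain ⟨j, hj, h⟩ := h
  refine ⟨j, hj, ?_⟩
  rw [mem_andPair_iff, mem_andPair_iff]
  rcases h with ⟨h2, h3⟩ | ⟨h2, h3⟩
  · exact ⟨Or.inl h2.symm, Or.inr h3.symm⟩
  · exact ⟨Or.inr h3.symm, Or.inl h2.symm⟩

/-! ## The main theorem -/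

section Main

variable {I : LocalMap 4 n m} (hI : I.IsPure xorAndPred) (hS : SimpleOverlap I) {r : ℕ} (hB : BoundaryExpanding r I)
  {P G : Finset (Fin m)} {e : Fin m} (he : e ∉ P) (hGd : Disjoint G (insert e P)) (hr : (insert e P ∪ G).card ≤ r)
  (hcyc : ∀ j ∈ insert e P, ∀ s : Fin 4, s.val < 2 → I.vars j s ∉ bdry I (insert e P))
  {μ₁ μ₂ m₁ m₂ : (Fin n → ZMod 2) → ZMod 2} (hμ₁ : IsAffineFn μ₁) (hμ₂ : IsAffineFn μ₂) (hm₁ : IsAffineFn m₁) (hm₂ : IsAffineFn m₂)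
  {c : ZMod 2} (hQ : ∀ x, qform P (fun j => I.vars j 2) (fun j => I.vars j 3) x + c = μ₁ x * m₁ x + μ₂ x * m₂ x)
  (hK : ∀ v w : Fin n, v ≠ w →
    linPart hμ₁ (Pi.single v 1) * linPart hμ₂ (Pi.single w 1) + linPart hμ₁ (Pi.single w 1) * linPart hμ₂ (Pi.single v 1) = 1 →
      ∃ g ∈ G, v ∈ andPair I g ∧ w ∈ andPair I g)

include hB hGd hr hcyc

/-- **Expansion kill**: gadgets `G' ⊆ G` on path variables with at most `k` leaves of `P` uncovered and
`2(2 + 2|G'| + k) < 3(|P ∪ {e}| + |G'|)` contradict `3/2`-expansion of `P ∪ {e} ∪ G'`. -/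
theorem false_of_gadgets (G' : Finset (Fin m)) (hG'G : G' ⊆ G) (hgv : ∀ g ∈ G', ∀ v ∈ andPair I g, ∃ j ∈ P, v ∈ andPair I j) (k : ℕ)
    (hk : ((univ.filter fun v => adeg I P v = 1).filter fun v => ∀ g ∈ G', v ∉ andPair I g).card ≤ k)
    (hlt : 2 * (2 + 2 * G'.card + k) < 3 * ((insert e P).card + G'.card)) : False := by
  classical
  have hdis : Disjoint G' (insert e P) := Disjoint.mono_left hG'G hGd
  have hcard : (insert e P ∪ G').card = (insert e P).card + G'.card := card_union_of_disjoint hdis.symm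
  have hsub : insert e P ∪ G' ⊆ insert e P ∪ G := union_subset_union (Subset.refl _) hG'G
  have h1 := hB (insert e P ∪ G') ((card_le_card hsub).trans hr)
  have h2 := card_bdry_union_le (I := I) hcyc G' hdis hgv
  rw [hcard] at h1
  omega

include he hI hS hμ₁ hμ₂ hm₁ hm₂ hQ hK

omit hI hS hm₁ hm₂ hQ in
/-- **Two gadgets on two disjoint cross pairs of `2K₂` are fatal** (`5` outputs, every leaf covered, at most `6` boundary variables). -/
theorem false_of_cross_gadgets {jσ jτ : Fin m} (hP : P = {jσ, jτ}) (hne : jσ ≠ jτ) (hdisj : Disjoint (andPair I jσ) (andPair I jτ))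
    {x x' y y' : Fin n} (hx : x ∈ andPair I jσ) (hx' : x' ∈ andPair I jσ) (hxx' : x ≠ x') (hy : y ∈ andPair I jτ) (hy' : y' ∈ andPair I jτ)
    (hyy' : y ≠ y')
    (hd : linPart hμ₁ (Pi.single x 1) * linPart hμ₂ (Pi.single y 1) + linPart hμ₁ (Pi.single y 1) * linPart hμ₂ (Pi.single x 1) = 1)
    (hd' : linPart hμ₁ (Pi.single x' 1) * linPart hμ₂ (Pi.single y' 1) + linPart hμ₁ (Pi.single y' 1) * linPart hμ₂ (Pi.single x' 1) = 1) :
    False := by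
  classical
  have hjσ : jσ ∈ P := by rw [hP]; exact mem_insert_self _ _
  have hjτ : jτ ∈ P := by rw [hP]; exact mem_insert_of_mem (mem_singleton_self _)
  have hxne : ∀ {a b : Fin n}, a ∈ andPair I jσ → b ∈ andPair I jτ → a ≠ b := fun ha hb h =>
    Finset.disjoint_left.1 hdisj ha (h ▸ hb)
  obtain ⟨g₁, hg₁, hxg₁, hyg₁⟩ := hK x y (hxne hx hy) hd
  obtain ⟨g₂, hg₂, hxg₂, hyg₂⟩ := hK x' y' (hxne hx' hy') hd'
  have hA₁ := andPair_eq_of_mem hxg₁ hyg₁ (hxne hx hy)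
  have hA₂ := andPair_eq_of_mem hxg₂ hyg₂ (hxne hx' hy')
  have hg12 : g₁ ≠ g₂ := by
    intro h
    rw [h, hA₂, mem_insert, mem_singleton] at hxg₁
    rcases hxg₁ with h | h
    · exact hxx' h
    · exact hxne hx hy' h
  refine false_of_gadgets hB hGd hr hcyc {g₁, g₂} ?_ ?_ 0 ?_ ?_
  · intro g hg
    rw [mem_insert, mem_singleton] at hg
    rcases hg with rfl | rfl
    · exact hg₁
    · exact hg₂
  · intro g hg v hv
    rw [mem_insert, mem_singleton] at hg
    rcases hg with rfl | rfl
    · rw [hA₁, mem_insert, mem_singleton] at hv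
      rcases hv with rfl | rfl
      · exact ⟨jσ, hjσ, hx⟩
      · exact ⟨jτ, hjτ, hy⟩
    · rw [hA₂, mem_insert, mem_singleton] at hv
      rcases hv with rfl | rfl
      · exact ⟨jσ, hjσ, hx'⟩
      · exact ⟨jτ, hjτ, hy'⟩
  · refine le_of_eq (card_eq_zero.2 (eq_empty_of_forall_notMem fun v hv => ?_))
    rw [mem_filter, mem_filter] at hv
    obtain ⟨⟨-, hv1⟩, hvg⟩ := hv
    obtain ⟨j, hj⟩ := card_pos.1 (show 0 < adeg I P v by rw [hv1]; exact Nat.one_pos)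
    rw [mem_filter, hP, mem_insert, mem_singleton] at hj
    have hn1 := hvg g₁ (mem_insert_self _ _)
    have hn2 := hvg g₂ (mem_insert_of_mem (mem_singleton_self _))
    rw [hA₁, mem_insert, mem_singleton, not_or] at hn1
    rw [hA₂, mem_insert, mem_singleton, not_or] at hn2
    have hjσ2 : andPair I jσ = {x, x'} := andPair_eq_of_mem hx hx' hxx'
    have hjτ2 : andPair I jτ = {y, y'} := andPair_eq_of_mem hy hy' hyy'
    rcases hj with ⟨rfl | rfl, hvj⟩
    · rw [hjσ2, mem_insert, mem_singleton] at hvj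
      rcases hvj with rfl | rfl
      · exact hn1.1 rfl
      · exact hn2.1 rfl
    · rw [hjτ2, mem_insert, mem_singleton] at hvj
      rcases hvj with rfl | rfl
      · exact hn1.2 rfl
      · exact hn2.2 rfl
  · have hc1 : (insert e P).card = 3 := by rw [card_insert_of_notMem he, hP, card_pair hne]
    rw [hc1, card_pair hg12]; norm_num

/-- **The `2K₂` endgame.**  Edges `jσ = (σ, σ')`, `jτ = (τ, τ')` with disjoint AND pairs, `σ` and `τ` literal.  If `τ'` is not literal then
`σ'` is not literal either (else two gadgets `(σ,τ), (σ',τ)` leave only `τ'` uncovered: `5` outputs, `≤ 7` boundary variables); if all four are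
literal, a cross perfect matching of distinct-profile pairs exists (`three_profiles`) and `false_of_cross_gadgets` applies.  What is left: the
literals are exactly `σ, τ`, `det(π_σ, π_τ) = 1` (`det_of_outside` at `σ'`), and the gadget `(σ,τ)` exists. -/
theorem of_lits {jσ jτ : Fin m} {σ σ' τ τ' : Fin n} (hP : P = {jσ, jτ}) (hne : jσ ≠ jτ) (hdisj : Disjoint (andPair I jσ) (andPair I jτ))
    (hσe : andPair I jσ = {σ, σ'}) (hτe : andPair I jτ = {τ, τ'}) (hσσ' : σ ≠ σ') (hττ' : τ ≠ τ')
    (hrank : finrank (ZMod 2) (rad (polar P (fun j => I.vars j 2) (fun j => I.vars j 3))) + 4 ≤ finrank (ZMod 2) (Fin n → ZMod 2))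
    (hlσ : linPart hμ₁ (Pi.single σ 1) ≠ 0 ∨ linPart hμ₂ (Pi.single σ 1) ≠ 0)
    (hlτ : linPart hμ₁ (Pi.single τ 1) ≠ 0 ∨ linPart hμ₂ (Pi.single τ 1) ≠ 0)
    (hnτ' : ¬ (linPart hμ₁ (Pi.single τ' 1) ≠ 0 ∨ linPart hμ₂ (Pi.single τ' 1) ≠ 0)) :
    ∃ j₁ j₂ : Fin m, ∃ σ τ : Fin n, j₁ ≠ j₂ ∧ P = {j₁, j₂} ∧ Disjoint (andPair I j₁) (andPair I j₂) ∧ σ ∈ andPair I j₁ ∧ τ ∈ andPair I j₂ ∧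
      (∀ v : Fin n, (linPart hμ₁ (Pi.single v 1) ≠ 0 ∨ linPart hμ₂ (Pi.single v 1) ≠ 0) ↔ (v = σ ∨ v = τ)) ∧
      ∃ g ∈ G, σ ∈ andPair I g ∧ τ ∈ andPair I g := by
  classical
  have hadj := adj_eq hμ₁ hμ₂ hm₁ hm₂ hQ hI hS
  have hjσ : jσ ∈ P := by rw [hP]; exact mem_insert_self _ _
  have hjτ : jτ ∈ P := by rw [hP]; exact mem_insert_of_mem (mem_singleton_self _)
  have hσm : σ ∈ andPair I jσ := by rw [hσe]; exact mem_insert_self _ _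
  have hσ'm : σ' ∈ andPair I jσ := by rw [hσe]; exact mem_insert_of_mem (mem_singleton_self _)
  have hτm : τ ∈ andPair I jτ := by rw [hτe]; exact mem_insert_self _ _
  have hτ'm : τ' ∈ andPair I jτ := by rw [hτe]; exact mem_insert_of_mem (mem_singleton_self _)
  have hcross : ∀ {x y : Fin n}, x ∈ andPair I jσ → y ∈ andPair I jτ → ¬ AndAdj I P x y := by
    intro x y hx hy hA
    obtain ⟨j, hj, hxj, hyj⟩ := mem_of_andAdj hA
    rw [hP, mem_insert, mem_singleton] at hj
    rcases hj with rfl | rfl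
    · exact Finset.disjoint_left.1 hdisj hyj hy
    · exact Finset.disjoint_left.1 hdisj hx hxj
  have hστ : σ ≠ τ := fun h => Finset.disjoint_left.1 hdisj hσm (h ▸ hτm)
  -- adjacency values
  have e2 := hadj τ τ'; rw [if_pos (andAdj_of_mem hjτ hττ' hτm hτ'm)] at e2
  have z2 := hadj σ τ'; rw [if_neg (hcross hσm hτ'm)] at z2
  have z4 := hadj σ' τ'; rw [if_neg (hcross hσ'm hτ'm)] at z4
  push Not at hnτ'
  obtain ⟨h0₁, h0₂⟩ := hnτ'
  -- `det(π_σ, π_τ) = 1` from the outside vertex `τ'`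
  have hd1 : linPart hμ₁ (Pi.single τ 1) * linPart hμ₂ (Pi.single σ 1) +
      linPart hμ₁ (Pi.single σ 1) * linPart hμ₂ (Pi.single τ 1) = 1 := det_of_outside h0₁ h0₂ e2 z2 hlσ
  by_cases hlσ' : linPart hμ₁ (Pi.single σ' 1) ≠ 0 ∨ linPart hμ₂ (Pi.single σ' 1) ≠ 0
  · -- `σ'` literal too: gadgets `(σ, τ)` and `(σ', τ)` leave only `τ'` uncovered
    exfalso
    have hd2 := det_of_outside h0₁ h0₂ e2 z4 hlσ'
    have hσ'τ : σ' ≠ τ := fun h => Finset.disjoint_left.1 hdisj hσ'm (h ▸ hτm)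
    obtain ⟨g₁, hg₁, hσg₁, hτg₁⟩ := hK σ τ hστ (by rw [add_comm]; exact hd1)
    obtain ⟨g₂, hg₂, hσg₂, hτg₂⟩ := hK σ' τ hσ'τ (by rw [add_comm]; exact hd2)
    have hA₁ := andPair_eq_of_mem hσg₁ hτg₁ hστ
    have hA₂ := andPair_eq_of_mem hσg₂ hτg₂ hσ'τ
    have hg12 : g₁ ≠ g₂ := by
      intro h
      rw [h, hA₂, mem_insert, mem_singleton] at hσg₁
      rcases hσg₁ with h | h
      · exact hσσ' h
      · exact hστ h
    refine false_of_gadgets hB hGd hr hcyc {g₁, g₂} ?_ ?_ 1 ?_ ?_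
    · intro g hg
      rw [mem_insert, mem_singleton] at hg
      rcases hg with rfl | rfl
      · exact hg₁
      · exact hg₂
    · intro g hg v hv
      rw [mem_insert, mem_singleton] at hg
      rcases hg with rfl | rfl
      · rw [hA₁, mem_insert, mem_singleton] at hv
        rcases hv with rfl | rfl
        · exact ⟨jσ, hjσ, hσm⟩
        · exact ⟨jτ, hjτ, hτm⟩
      · rw [hA₂, mem_insert, mem_singleton] at hv
        rcases hv with rfl | rfl
        · exact ⟨jσ, hjσ, hσ'm⟩
        · exact ⟨jτ, hjτ, hτm⟩
    · refine (card_le_card (fun v hv => ?_)).trans (card_singleton τ').le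
      rw [mem_filter, mem_filter] at hv
      obtain ⟨⟨-, hv1⟩, hvg⟩ := hv
      obtain ⟨j, hj⟩ := card_pos.1 (show 0 < adeg I P v by rw [hv1]; exact Nat.one_pos)
      rw [mem_filter, hP, mem_insert, mem_singleton] at hj
      have hn1 := hvg g₁ (mem_insert_self _ _)
      have hn2 := hvg g₂ (mem_insert_of_mem (mem_singleton_self _))
      rw [hA₁, mem_insert, mem_singleton, not_or] at hn1
      rw [hA₂, mem_insert, mem_singleton, not_or] at hn2
      rcases hj with ⟨rfl | rfl, hvj⟩
      · rw [hσe, mem_insert, mem_singleton] at hvj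
        rcases hvj with rfl | rfl
        · exact absurd rfl hn1.1
        · exact absurd rfl hn2.1
      · rw [hτe, mem_insert, mem_singleton] at hvj
        rcases hvj with rfl | rfl
        · exact absurd rfl hn1.2
        · exact mem_singleton_self _
    · have hc1 : (insert e P).card = 3 := by rw [card_insert_of_notMem he, hP, card_pair hne]
      rw [hc1, card_pair hg12]; norm_num
  · -- exactly `σ, τ` literal: the conclusion
    push Not at hlσ'
    obtain ⟨g, hg, hσg, hτg⟩ := hK σ τ hστ (by rw [add_comm]; exact hd1)
    refine ⟨jσ, jτ, σ, τ, hne, hP, hdisj, hσm, hτm, fun v => ⟨fun hv => ?_, ?_⟩, g, hg, hσg, hτg⟩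
    · obtain ⟨j, hj, hvj⟩ := exists_mem_andPair_of_lit hμ₁ hμ₂ hm₁ hm₂ hQ hrank hv
      rw [hP, mem_insert, mem_singleton] at hj
      rcases hj with rfl | rfl
      · rw [hσe, mem_insert, mem_singleton] at hvj
        rcases hvj with rfl | rfl
        · exact Or.inl rfl
        · exact (hv.elim (fun h => h hlσ'.1) fun h => h hlσ'.2).elim
      · rw [hτe, mem_insert, mem_singleton] at hvj
        rcases hvj with rfl | rfl
        · exact Or.inr rfl
        · exact (hv.elim (fun h => h h0₁) fun h => h h0₂).elim
    · rintro (rfl | rfl)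
      · exact hlσ
      · exact hlτ

/-- **Four literals on `2K₂` are impossible**: among the cross pairs `{σ,σ'} × {τ,τ'}` some perfect matching consists of two pairs with
distinct profiles (otherwise three of the four profiles coincide, contradicting `three_profiles'`), and `false_of_cross_gadgets` applies. -/
theorem false_of_four_lit {jσ jτ : Fin m} {σ σ' τ τ' : Fin n} (hP : P = {jσ, jτ}) (hne : jσ ≠ jτ)
    (hdisj : Disjoint (andPair I jσ) (andPair I jτ)) (hσe : andPair I jσ = {σ, σ'}) (hτe : andPair I jτ = {τ, τ'}) (hσσ' : σ ≠ σ')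
    (hττ' : τ ≠ τ') (hlσ : linPart hμ₁ (Pi.single σ 1) ≠ 0 ∨ linPart hμ₂ (Pi.single σ 1) ≠ 0)
    (hlσ' : linPart hμ₁ (Pi.single σ' 1) ≠ 0 ∨ linPart hμ₂ (Pi.single σ' 1) ≠ 0)
    (hlτ : linPart hμ₁ (Pi.single τ 1) ≠ 0 ∨ linPart hμ₂ (Pi.single τ 1) ≠ 0)
    (hlτ' : linPart hμ₁ (Pi.single τ' 1) ≠ 0 ∨ linPart hμ₂ (Pi.single τ' 1) ≠ 0) : False := by
  classical
  have hadj := adj_eq hμ₁ hμ₂ hm₁ hm₂ hQ hI hS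
  have hjσ : jσ ∈ P := by rw [hP]; exact mem_insert_self _ _
  have hjτ : jτ ∈ P := by rw [hP]; exact mem_insert_of_mem (mem_singleton_self _)
  have hσm : σ ∈ andPair I jσ := by rw [hσe]; exact mem_insert_self _ _
  have hσ'm : σ' ∈ andPair I jσ := by rw [hσe]; exact mem_insert_of_mem (mem_singleton_self _)
  have hτm : τ ∈ andPair I jτ := by rw [hτe]; exact mem_insert_self _ _
  have hτ'm : τ' ∈ andPair I jτ := by rw [hτe]; exact mem_insert_of_mem (mem_singleton_self _)
  -- cross pairs are not adjacent (in either order)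
  have hcross : ∀ {x y : Fin n}, (x ∈ andPair I jσ ∧ y ∈ andPair I jτ) ∨ (x ∈ andPair I jτ ∧ y ∈ andPair I jσ) → ¬ AndAdj I P x y := by
    intro x y hxy hA
    obtain ⟨j, hj, hxj, hyj⟩ := mem_of_andAdj hA
    rw [hP, mem_insert, mem_singleton] at hj
    rcases hxy with ⟨hx, hy⟩ | ⟨hx, hy⟩ <;> rcases hj with rfl | rfl
    · exact Finset.disjoint_left.1 hdisj hyj hy
    · exact Finset.disjoint_left.1 hdisj hx hxj
    · exact Finset.disjoint_left.1 hdisj hxj hx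
    · exact Finset.disjoint_left.1 hdisj hy hyj
  have e1 := hadj σ σ'; rw [if_pos (andAdj_of_mem hjσ hσσ' hσm hσ'm)] at e1
  have e2 := hadj τ τ'; rw [if_pos (andAdj_of_mem hjτ hττ' hτm hτ'm)] at e2
  have z1 := hadj σ τ; rw [if_neg (hcross (Or.inl ⟨hσm, hτm⟩))] at z1
  have z2 := hadj σ τ'; rw [if_neg (hcross (Or.inl ⟨hσm, hτ'm⟩))] at z2
  have z3 := hadj σ' τ; rw [if_neg (hcross (Or.inl ⟨hσ'm, hτm⟩))] at z3
  have z4 := hadj σ' τ'; rw [if_neg (hcross (Or.inl ⟨hσ'm, hτ'm⟩))] at z4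
  have y1 := hadj τ σ; rw [if_neg (hcross (Or.inr ⟨hτm, hσm⟩))] at y1
  have y2 := hadj τ σ'; rw [if_neg (hcross (Or.inr ⟨hτm, hσ'm⟩))] at y2
  have y3 := hadj τ' σ; rw [if_neg (hcross (Or.inr ⟨hτ'm, hσm⟩))] at y3
  have y4 := hadj τ' σ'; rw [if_neg (hcross (Or.inr ⟨hτ'm, hσ'm⟩))] at y4
  -- the four "three equal profiles" combinations
  have C1 : (linPart hμ₁ (Pi.single σ 1) = linPart hμ₁ (Pi.single τ 1) ∧ linPart hμ₂ (Pi.single σ 1) = linPart hμ₂ (Pi.single τ 1)) →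
      (linPart hμ₁ (Pi.single σ 1) = linPart hμ₁ (Pi.single τ' 1) ∧ linPart hμ₂ (Pi.single σ 1) = linPart hμ₂ (Pi.single τ' 1)) → False :=
    fun h h' => three_profiles' h.1 h.2 h'.1 h'.2 e2 z1 z2
  have C2 : (linPart hμ₁ (Pi.single σ 1) = linPart hμ₁ (Pi.single τ 1) ∧ linPart hμ₂ (Pi.single σ 1) = linPart hμ₂ (Pi.single τ 1)) →
      (linPart hμ₁ (Pi.single σ' 1) = linPart hμ₁ (Pi.single τ 1) ∧ linPart hμ₂ (Pi.single σ' 1) = linPart hμ₂ (Pi.single τ 1)) → False :=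
    fun h h' => three_profiles' h.1.symm h.2.symm h'.1.symm h'.2.symm e1 y1 y2
  have C3 : (linPart hμ₁ (Pi.single σ' 1) = linPart hμ₁ (Pi.single τ' 1) ∧ linPart hμ₂ (Pi.single σ' 1) = linPart hμ₂ (Pi.single τ' 1)) →
      (linPart hμ₁ (Pi.single σ 1) = linPart hμ₁ (Pi.single τ' 1) ∧ linPart hμ₂ (Pi.single σ 1) = linPart hμ₂ (Pi.single τ' 1)) → False :=
    fun h h' => three_profiles' h'.1.symm h'.2.symm h.1.symm h.2.symm e1 y3 y4
  have C4 : (linPart hμ₁ (Pi.single σ' 1) = linPart hμ₁ (Pi.single τ' 1) ∧ linPart hμ₂ (Pi.single σ' 1) = linPart hμ₂ (Pi.single τ' 1)) →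
      (linPart hμ₁ (Pi.single σ' 1) = linPart hμ₁ (Pi.single τ 1) ∧ linPart hμ₂ (Pi.single σ' 1) = linPart hμ₂ (Pi.single τ 1)) → False :=
    fun h h' => three_profiles' h'.1 h'.2 h.1 h.2 e2 z3 z4
  have killA := fun d1 d2 => false_of_cross_gadgets hB he hGd hr hcyc hμ₁ hμ₂ hK hP hne hdisj hσm hσ'm hσσ' hτm hτ'm hττ' d1 d2
  have killB := fun d3 d4 => false_of_cross_gadgets hB he hGd hr hcyc hμ₁ hμ₂ hK hP hne hdisj hσm hσ'm hσσ' hτ'm hτm hττ'.symm d3 d4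
  rcases det_or_eq hlσ hlτ with d1 | P1 <;> rcases det_or_eq hlσ' hlτ' with d2 | P2
  · exact killA d1 d2
  · rcases det_or_eq hlσ hlτ' with d3 | P3 <;> rcases det_or_eq hlσ' hlτ with d4 | P4
    · exact killB d3 d4
    · exact C4 P2 P4
    · exact C3 P2 P3
    · exact C4 P2 P4
  · rcases det_or_eq hlσ hlτ' with d3 | P3 <;> rcases det_or_eq hlσ' hlτ with d4 | P4
    · exact killB d3 d4
    · exact C2 P1 P4
    · exact C1 P1 P3
    · exact C1 P1 P3
  · rcases det_or_eq hlσ hlτ' with d3 | P3 <;> rcases det_or_eq hlσ' hlτ with d4 | P4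
    · exact killB d3 d4
    · exact C2 P1 P4
    · exact C1 P1 P3
    · exact C1 P1 P3

end Main

end Summit.PneNP.PneNP.Theorems.PstarNorUnitCases
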